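import Summits.CriticalPhenomena.Ising3DConformalLimit.Theses.AnomalousForcesInteraction
import Summits.CriticalPhenomena.Ising3DConformalLimit.Theorems.CanonicalBranchRefutationInfraredExponentZeroSharpHalfBet
import Summits.CriticalPhenomena.Ising3DConformalLimit.Theorems.AnomalousForcesInteractionEtaPositiveOfIsotherm
import Literature.Probability.LatticeModels.CriticalScalingDimension
import HarnessLib

/-!
# Crux `EtaPositive` (stmt-CriticalPhenomena-2600): the admissible windows of the crux and of its stub

Route `AnomalousForcesInteraction` (Ising3DConformalLimit), line `registered`. Calibration ("tightness")
theorems for the crux `EtaPositive := ∃ κ > 0, C, ∀ x ≠ 0, ⟨σ₀σ_x⟩⁺_{β_c(3)} ≤ C‖x‖^{-(1+κ)}` and for its one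
open stub `stub_isothermGain := ∃ b > 1/5, A, h₀ > 0, ∀ h ∈ (0,h₀], m(β_c(3),h) ≤ A h^b`, all UNCONDITIONAL
theorems about the nearest-neighbour Ising model on `ℤ³` (no exponent is assumed to exist):

* `EtaPositive_exponent_le_half` — any power upper bound `⟨σ₀σ_x⟩⁺_{β_c(3)} ≤ C‖x‖^{-(1+κ)}` (`x ≠ 0`) has
  `κ ≤ 1/2`: the sharp subsequence floor `c n^{-3/2} ≤ ⟨σ₀σ_{ne₁}⟩` infinitely often
  (`exists_frequently_mul_rpow_le_criticalTwoPoint_axis`, Duminil-Copin–Panis 2025 Thm 1.3 run at exponent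
  `3/2`) is incompatible with `κ > 1/2`. So a witness of the crux lives in the window `κ ∈ (0, 1/2]`
  (`EtaPositive_iff_window`).
* `isothermGain_exponent_le_third` — **`δ ≥ 3` in upper-bound form on `ℤ³`, unconditionally**: any upper
  critical-isotherm bound `m(β_c(3),h) ≤ A h^b` on `(0,h₀]` with `b > 0` has `b ≤ 1/3`. Proof: the effective
  Buckingham–Gunton transport `criticalTwoPoint_decay_of_isotherm` (landed, p149328) turns it into
  `⟨σ₀σ_x⟩ ≤ C‖x‖^{-6b/(b+1)} = C‖x‖^{-(1+κ_b)}`, `κ_b = (5b-1)/(b+1)`, and `κ_b ≤ 1/2 ⟺ b ≤ 1/3`. (The value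
  `1/3` is the mean-field exponent of Aizenman–Barsky–Fernández's `δ ≥ 3`, here recovered from the two-point
  lower bound instead of the `φ⁴`/GHS differential inequalities.)
* `not_isothermGain_above_third` — the strengthening of `stub_isothermGain` with threshold `1/3` in place of
  `1/5` is FALSE; the stub's admissible window is `b ∈ (1/5, 1/3]` (conjecturally `1/δ ≈ 0.2088`).

No named fact is assumed; standard axioms.
-/

noncomputable section

namespace Summit.CriticalPhenomena.Ising3DConformalLimit.AnomalousForcesInteractionEtaPositive

open Filter Topology Literature.Probability.LatticeModels

/-- **The exponent window of the crux.** If `⟨σ₀σ_x⟩⁺_{β_c(3)} ≤ C ‖x‖^{-(1+κ)}` for every `x ≠ 0` in `ℤ³`,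
then `κ ≤ 1/2`: otherwise the subsequence floor `c n^{-3/2} ≤ ⟨σ₀σ_{n e₁}⟩⁺_{β_c(3)}` (infinitely many `n`,
Duminil-Copin–Panis 2025 Thm 1.3 at exponent `3/2`, tree theorem
`exists_frequently_mul_rpow_le_criticalTwoPoint_axis`) would give `c ≤ C n^{1/2-κ} → 0`.
Registered stub of stmt-CriticalPhenomena-2600 (verbatim one-line header). -/
theorem EtaPositive_exponent_le_half : ∀ κ C : ℝ, (∀ x : Literature.Probability.LatticeModels.Site 3, x ≠ 0 → Literature.Probability.LatticeModels.criticalTwoPoint 3 x ≤ C * (‖x‖ : ℝ) ^ (-(1 + κ))) → κ ≤ 1 / 2 := by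
  intro κ C h
  by_contra hκ
  push Not at hκ
  obtain ⟨c, hc, hfreq⟩ :=
    Summit.CriticalPhenomena.Ising3DConformalLimit.Theorems.exists_frequently_mul_rpow_le_criticalTwoPoint_axis
  -- `C n^{-(κ - 1/2)} → 0`
  have hlim : Tendsto (fun n : ℕ => C * (n : ℝ) ^ (-(κ - 1 / 2))) atTop (𝓝 0) := by
    have h1 : Tendsto (fun t : ℝ => t ^ (-(κ - 1 / 2))) atTop (𝓝 0) :=
      tendsto_rpow_neg_atTop (y := κ - 1 / 2) (by linarith)
    have h2 : Tendsto (fun n : ℕ => (n : ℝ) ^ (-(κ - 1 / 2))) atTop (𝓝 0) :=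
      h1.comp tendsto_natCast_atTop_atTop
    simpa only [mul_zero] using h2.const_mul C
  have hev : ∀ᶠ n : ℕ in atTop, C * (n : ℝ) ^ (-(κ - 1 / 2)) < c := hlim.eventually (gt_mem_nhds hc)
  obtain ⟨n, hfloor, hlt, hn1⟩ := (hfreq.and_eventually (hev.and (eventually_ge_atTop 1))).exists
  have hn0 : (0 : ℝ) < n := by exact_mod_cast hn1
  -- the axis point `n e₁ ≠ 0`, `‖n e₁‖ = n`
  have hx : (Pi.single 0 (n : ℤ) : Site 3) ≠ 0 := by
    intro h0
    have h00 := congrFun h0 0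
    simp only [Pi.single_eq_same, Pi.zero_apply, Nat.cast_eq_zero] at h00
    omega
  have hup := h _ hx
  rw [norm_single_axis, Int.cast_natCast, abs_of_nonneg hn0.le] at hup
  -- `c n^{-3/2} ≤ C n^{-(1+κ)}`, i.e. `c ≤ C n^{-(κ-1/2)} < c`
  have hchain : c * (n : ℝ) ^ (-(3 / 2 : ℝ)) ≤ C * (n : ℝ) ^ (-(1 + κ)) := hfloor.trans hup
  have hp : 0 < (n : ℝ) ^ (3 / 2 : ℝ) := Real.rpow_pos_of_pos hn0 _
  have hmul := mul_le_mul_of_nonneg_right hchain hp.le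
  have e1 : c * (n : ℝ) ^ (-(3 / 2 : ℝ)) * (n : ℝ) ^ (3 / 2 : ℝ) = c := by
    rw [mul_assoc, ← Real.rpow_add hn0]; norm_num
  have e2 : C * (n : ℝ) ^ (-(1 + κ)) * (n : ℝ) ^ (3 / 2 : ℝ) = C * (n : ℝ) ^ (-(κ - 1 / 2)) := by
    rw [mul_assoc, ← Real.rpow_add hn0]
    congr 2; ring
  rw [e1, e2] at hmul
  linarith

/-- **The crux with its window made explicit**: `EtaPositive` holds iff it holds with an exponent
`κ ∈ (0, 1/2]` (`EtaPositive_exponent_le_half`). Registered stub of stmt-CriticalPhenomena-2600 (verbatim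
one-line header). -/
theorem EtaPositive_iff_window : Summit.CriticalPhenomena.Ising3DConformalLimit.Theses.AnomalousForcesInteraction.EtaPositive ↔ ∃ κ C : ℝ, 0 < κ ∧ κ ≤ 1 / 2 ∧ ∀ x : Literature.Probability.LatticeModels.Site 3, x ≠ 0 → Literature.Probability.LatticeModels.criticalTwoPoint 3 x ≤ C * (‖x‖ : ℝ) ^ (-(1 + κ)) := by
  unfold Summit.CriticalPhenomena.Ising3DConformalLimit.Theses.AnomalousForcesInteraction.EtaPositive
  constructor
  · rintro ⟨κ, C, hκ, h⟩
    exact ⟨κ, C, hκ, EtaPositive_exponent_le_half κ C h, h⟩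
  · rintro ⟨κ, C, hκ, -, h⟩
    exact ⟨κ, C, hκ, h⟩

/-- **`δ ≥ 3` in upper-bound form on `ℤ³`, unconditionally.** If the critical isotherm of the
nearest-neighbour Ising model on `ℤ³` satisfies `m(β_c, h) ≤ A h^b` for all `h ∈ (0, h₀]` with some `b > 0`,
then `b ≤ 1/3`. Proof: the effective Buckingham–Gunton transport (`criticalTwoPoint_decay_of_isotherm`,
p149328) gives `⟨σ₀σ_x⟩⁺_{β_c} ≤ C‖x‖^{-6b/(b+1)}`, `6b/(b+1) = 1 + (5b-1)/(b+1)`, and the window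
`(5b-1)/(b+1) ≤ 1/2` (`EtaPositive_exponent_le_half`) is `b ≤ 1/3`. Registered stub of
stmt-CriticalPhenomena-2600 (verbatim one-line header). -/
theorem isothermGain_exponent_le_third : ∀ b A h₀ : ℝ, 0 < b → 0 < h₀ → (∀ h : ℝ, 0 < h → h ≤ h₀ → Literature.Probability.LatticeModels.magnetizationInField 3 (Literature.Probability.LatticeModels.criticalBeta 3) h ≤ A * h ^ b) → b ≤ 1 / 3 := by
  intro b A h₀ hb hh₀ hM
  obtain ⟨C, hC⟩ := criticalTwoPoint_decay_of_isotherm b A h₀ hb hh₀ hM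
  have hb1 : b + 1 ≠ 0 := by
    have : 0 < b + 1 := by linarith
    exact this.ne'
  have hexp : (6 * b / (b + 1) : ℝ) = 1 + (5 * b - 1) / (b + 1) := by
    field_simp
    ring
  have hC' : ∀ x : Site 3, x ≠ 0 →
      criticalTwoPoint 3 x ≤ C * (‖x‖ : ℝ) ^ (-(1 + (5 * b - 1) / (b + 1))) := by
    intro x hx
    have := hC x hx
    rwa [hexp] at this
  have hκ := EtaPositive_exponent_le_half ((5 * b - 1) / (b + 1)) C hC'
  rw [div_le_iff₀ (by linarith : (0 : ℝ) < b + 1)] at hκ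
  linarith

/-- **The strengthening of `stub_isothermGain` past `1/3` is false.** There are NO `b > 1/3`, `A`, `h₀ > 0` with
`m(β_c(3), h) ≤ A h^b` on `(0, h₀]` (`isothermGain_exponent_le_third`): the admissible window of the registered
stub (threshold `1/5`) is `b ∈ (1/5, 1/3]`. Registered stub of stmt-CriticalPhenomena-2600 (verbatim one-line
header). -/
theorem not_isothermGain_above_third : ¬ ∃ b A h₀ : ℝ, 1 / 3 < b ∧ 0 < h₀ ∧ ∀ h : ℝ, 0 < h → h ≤ h₀ → Literature.Probability.LatticeModels.magnetizationInField 3 (Literature.Probability.LatticeModels.criticalBeta 3) h ≤ A * h ^ b := by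
  rintro ⟨b, A, h₀, hb, hh₀, hM⟩
  have := isothermGain_exponent_le_third b A h₀ (by linarith) hh₀ hM
  linarith

end Summit.CriticalPhenomena.Ising3DConformalLimit.AnomalousForcesInteractionEtaPositive
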